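/- Free-seat work of WIDTH SEAT 2/3 `ym-line-cbag-p1-w2` (prover-ym-line-cbag-p1-w2-g16-0), route `EguchiKawaiDirectionLadder`
(ideator ym-idea-2, LINE 8), crux K_A `TripleSmallBallMargin` (stmt-QuantumFields-27724), OFF-BLOCK LEVEL of stub (b♯): the block choice
from a PAIR PROFILE (resolution `r`), so that the landed off-diagonal-block small-ball bound `HaarColumns.haar_offDiagBlockSq_smallBall` can
be applied to `U₂`, `U₃` in the eigenbasis of `U₁`.  ROUTE-INDEPENDENT (no Theses import).  Nothing here bears on the YM mass gap. -/
import Summits.QuantumFields.YangMills.Theorems.EguchiKawaiDirectionLadderSingleLinkBlocksCounting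

/-!
# Block labels from a pair profile: same block ⇒ `r`-close, different blocks ⇒ `γ`-separated

`blocks_from_pair_profile`: for every resolution `0 < r ≤ 1` and collar parameter `M ≥ 2` there are `m` (number of arcs) and `γ > 0`
such that EVERY unit-modulus family `d : Fin N → ℂ` admits a labelling `ℓ : Fin N → Option (Fin m)` (`none` = collar/free index) with

* SEPARATION across blocks: `ℓ j ≠ ℓ k`, both labelled ⇒ `|d_j − d_k|² ≥ γ` (`blockLabel_separated` of part 1);
* CLOSENESS inside blocks: `ℓ j = ℓ k = some a` ⇒ `|d_j − d_k| ≤ r` (arcs of `M` cells have angular width `2π/m ≤ r`);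
* FEW COLLARS: at least `N − N/M` labelled indices (`exists_shift_few_collars` of part 2);

hence the COUNT `labelPairCount ℓ ≥ (N − N/M)² − #{(j,k) : |d_j − d_k| ≤ r}`: the number of ordered cross-block pairs is at least
`T² − Σ_a n_a²` and same-block pairs are `r`-close.  With `#{r-close ordered pairs} ≤ S·N²` (pair mass `≤ S` at resolution `r`, e.g.
`pairMass r (U 0) ≤ S` for the spectrum of the first link) this gives `labelPairCount ℓ / 2 ≥ ((1 − S)/2 − 1/M)·N²` unordered cross pairs —
the exponent `(1 − S − 2/M)` for TWO independent Haar links `U₂, U₃` via `haar_offDiagBlockSq_smallBall`, i.e. the off-block term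
`(1 − η)(1 − S)` of `ProfileResolvedBound` (stub (b♯) of stmt-QuantumFields-27724).  The within-block level (stub (a♯)) is NOT touched.

Deterministic and `N`-free.  Barrier-ledger line (`EguchiKawaiBreakdown`); nothing here bears on the Yang–Mills mass gap.
-/

set_option autoImplicit false

noncomputable section

open scoped Real
open Finset

namespace Summit.QuantumFields.YangMills.Theorems.EguchiKawaiDirectionLadder

/-! ### Same block ⇒ close -/

/-- Two angles in the SAME arc (label `some a`) differ, modulo `2π`, by at most the arc width `M·w = 2π/m`:
`cos(φ(z) − φ(z')) ≥ cos(2π/m)` (for `m ≥ 2`). -/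
theorem cos_angleOf_sub_ge_of_blockLabel_eq {m M r : ℕ} (hm : 2 ≤ m) (hr : r < m * M) {z z' : ℂ} {a : Fin m}
    (ha : blockLabel m M r z = some a) (ha' : blockLabel m M r z' = some a) :
    Real.cos (2 * π / m) ≤ Real.cos (angleOf z - angleOf z') := by
  obtain ⟨hK, -, hdiv⟩ := blockLabel_eq_some_iff.1 ha
  obtain ⟨-, -, hdiv'⟩ := blockLabel_eq_some_iff.1 ha'
  set K : ℕ := m * M with hKdef
  set c := cellOf K z with hcdef
  set c' := cellOf K z' with hc'def
  set x := relPos m M r c with hxdef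
  set y := relPos m M r c' with hydef
  have hMpos : 0 < M := Nat.pos_of_mul_pos_left hK
  have hmpos : 0 < m := lt_of_lt_of_le (by norm_num) hm
  have hKpos : (0 : ℝ) < K := by exact_mod_cast hK
  set w : ℝ := 2 * π / K with hw
  have hwpos : 0 < w := by positivity
  have hKw : (K : ℝ) * w = 2 * π := by rw [hw]; field_simp
  have hMw : (M : ℝ) * w = 2 * π / m := by rw [hw, hKdef]; push_cast; field_simp
  -- positions in the same arc
  have hx1 : a.val * M ≤ x := by rw [← hdiv]; exact Nat.div_mul_le_self x M
  have hx2 : x < a.val * M + M := by rw [← hdiv]; exact Nat.lt_div_mul_add hMpos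
  have hy1 : a.val * M ≤ y := by rw [← hdiv']; exact Nat.div_mul_le_self y M
  have hy2 : y < a.val * M + M := by rw [← hdiv']; exact Nat.lt_div_mul_add hMpos
  have hcK : c < K := cellOf_lt hK z
  have hc'K : c' < K := cellOf_lt hK z'
  have hqc : (K : ℝ) * ((c + K - r) / K : ℕ) + x = c + K - r := by
    have h := Nat.div_add_mod (c + K - r) K
    have hr' : r ≤ c + K := by omega
    have : ((K * ((c + K - r) / K) + (c + K - r) % K : ℕ) : ℝ) = ((c + K - r : ℕ) : ℝ) := by rw [h]
    rw [Nat.cast_sub hr'] at this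
    push_cast at this ⊢
    rw [hxdef, relPos]
    linarith
  have hqc' : (K : ℝ) * ((c' + K - r) / K : ℕ) + y = c' + K - r := by
    have h := Nat.div_add_mod (c' + K - r) K
    have hr' : r ≤ c' + K := by omega
    have : ((K * ((c' + K - r) / K) + (c' + K - r) % K : ℕ) : ℝ) = ((c' + K - r : ℕ) : ℝ) := by rw [h]
    rw [Nat.cast_sub hr'] at this
    push_cast at this ⊢
    rw [hydef, relPos]
    linarith
  obtain ⟨hφ1, hφ2⟩ := cellOf_mul_le hK z
  obtain ⟨hφ'1, hφ'2⟩ := cellOf_mul_le hK z'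
  set q : ℕ := (c + K - r) / K with hq
  set q' : ℕ := (c' + K - r) / K with hq'
  set v : ℝ := angleOf z - angleOf z' - ((q : ℤ) - q' : ℤ) * (2 * π) with hv
  have hcos : Real.cos (angleOf z - angleOf z') = Real.cos v := by
    rw [hv, Real.cos_sub_int_mul_two_pi]
  rw [hcos]
  have hv' : v = (angleOf z - c * w) - (angleOf z' - c' * w) + ((x : ℝ) - y) * w := by
    rw [hv, ← hKw]; push_cast
    have h1 : (c : ℝ) = x + r - K + K * q := by linarith
    have h2 : (c' : ℝ) = y + r - K + K * q' := by linarith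
    rw [h1, h2]; ring
  have hx1' : (a.val * M : ℝ) ≤ x := by exact_mod_cast hx1
  have hx2' : (x : ℝ) + 1 ≤ a.val * M + M := by exact_mod_cast hx2
  have hy1' : (a.val * M : ℝ) ≤ y := by exact_mod_cast hy1
  have hy2' : (y : ℝ) + 1 ≤ a.val * M + M := by exact_mod_cast hy2
  have hxy1 : ((x : ℝ) - y) * w ≤ ((M : ℝ) - 1) * w :=
    mul_le_mul_of_nonneg_right (by linarith) hwpos.le
  have hxy2 : -(((M : ℝ) - 1) * w) ≤ ((x : ℝ) - y) * w := by
    have := mul_le_mul_of_nonneg_right (show -((M : ℝ) - 1) ≤ (x : ℝ) - y by linarith) hwpos.le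
    linarith
  have hA1 : 0 ≤ angleOf z - c * w := by linarith
  have hA2 : angleOf z - c * w ≤ w := by linarith
  have hB1 : 0 ≤ angleOf z' - c' * w := by linarith
  have hB2 : angleOf z' - c' * w ≤ w := by linarith
  have hvlo : -(2 * π / m) ≤ v := by
    rw [hv', ← hMw]; linarith
  have hvhi : v ≤ 2 * π / m := by
    rw [hv', ← hMw]; linarith
  have hπm : 2 * π / m ≤ π := by
    rw [div_le_iff₀ (by exact_mod_cast hmpos)]
    have : (2 : ℝ) ≤ m := by exact_mod_cast hm
    nlinarith [Real.pi_pos]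
  rw [← Real.cos_abs v]
  exact Real.cos_le_cos_of_nonneg_of_le_pi (abs_nonneg v) hπm (abs_le.2 ⟨hvlo, hvhi⟩)

/-- **Same block ⇒ `r`-close**: if the arc width `2π/m` is at most `r` (`m ≥ 2π/r`), two unit complex numbers with the same block
label are at chordal distance `≤ r`. -/
theorem norm_sub_le_of_blockLabel_eq {m M r : ℕ} {ρ : ℝ} (hm : 2 ≤ m) (hmρ : 2 * π / m ≤ ρ) (hr : r < m * M)
    {z z' : ℂ} (hz : ‖z‖ = 1) (hz' : ‖z'‖ = 1) {a : Fin m}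
    (ha : blockLabel m M r z = some a) (ha' : blockLabel m M r z' = some a) : ‖z - z'‖ ≤ ρ := by
  have hcos := cos_angleOf_sub_ge_of_blockLabel_eq hm hr ha ha'
  have hsq : ‖z - z'‖ ^ 2 ≤ ρ ^ 2 := by
    rw [norm_sub_sq_eq_angleOf hz hz']
    have h1 : 2 - 2 * Real.cos (angleOf z - angleOf z') ≤ 2 - 2 * Real.cos (2 * π / m) := by linarith
    have h2 : 2 - 2 * Real.cos (2 * π / m) ≤ (2 * π / m) ^ 2 := by
      nlinarith [Real.one_sub_sq_div_two_le_cos (x := 2 * π / m)]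
    have h3 : (2 * π / m) ^ 2 ≤ ρ ^ 2 := pow_le_pow_left₀ (by positivity) hmρ 2
    linarith
  have hρ : 0 ≤ ρ := le_trans (by positivity) hmρ
  nlinarith [norm_nonneg (z - z'), sq_nonneg (‖z - z'‖ - ρ)]

/-! ### The pair count against the profile -/

/-- For any labelling: the number of ordered cross-block pairs is at least `T² − #{(j,k) : both labelled, same label}`, where `T`
is the number of labelled indices. -/
theorem card_pairs_ge_sq_sub_same {N m : ℕ} (ℓ : Fin N → Option (Fin m)) :
    (((Finset.univ.filter fun k => ℓ k ≠ none).card : ℝ)) ^ 2 -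
        ((Finset.univ.filter fun p : Fin N × Fin N => ℓ p.1 = ℓ p.2 ∧ ℓ p.1 ≠ none).card : ℝ) ≤
      ((Finset.univ.filter fun p : Fin N × Fin N => ℓ p.1 ≠ ℓ p.2 ∧ ℓ p.1 ≠ none ∧ ℓ p.2 ≠ none).card : ℝ) := by
  set S := Finset.univ.filter fun k => ℓ k ≠ none with hS
  -- S × S ⊆ (cross pairs) ∪ (same-label labelled pairs)
  have hsub : S ×ˢ S ⊆
      (Finset.univ.filter fun p : Fin N × Fin N => ℓ p.1 ≠ ℓ p.2 ∧ ℓ p.1 ≠ none ∧ ℓ p.2 ≠ none) ∪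
        (Finset.univ.filter fun p : Fin N × Fin N => ℓ p.1 = ℓ p.2 ∧ ℓ p.1 ≠ none) := by
    intro p hp
    rw [Finset.mem_product, hS, Finset.mem_filter, Finset.mem_filter] at hp
    rw [Finset.mem_union, Finset.mem_filter, Finset.mem_filter]
    by_cases h : ℓ p.1 = ℓ p.2
    · exact Or.inr ⟨Finset.mem_univ _, h, hp.1.2⟩
    · exact Or.inl ⟨Finset.mem_univ _, h, hp.1.2, hp.2.2⟩
  have hcard := (Finset.card_le_card hsub).trans (Finset.card_union_le _ _)
  rw [Finset.card_product] at hcard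
  have h : ((S.card * S.card : ℕ) : ℝ) ≤
      (((Finset.univ.filter fun p : Fin N × Fin N => ℓ p.1 ≠ ℓ p.2 ∧ ℓ p.1 ≠ none ∧ ℓ p.2 ≠ none).card +
        (Finset.univ.filter fun p : Fin N × Fin N => ℓ p.1 = ℓ p.2 ∧ ℓ p.1 ≠ none).card : ℕ) : ℝ) := by
    exact_mod_cast hcard
  push_cast at h
  nlinarith [h]

/-- **Block labels from a pair profile.**  For `0 < ρ` and `M ≥ 2` there are `m` and `γ > 0` such that every unit-modulus family
`d : Fin N → ℂ` admits a block labelling with `γ`-separation across blocks and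
`labelPairCount ≥ (N − N/M)² − #{(j,k) : |d_j − d_k| ≤ ρ}` ordered cross pairs. -/
theorem blocks_from_pair_profile (ρ : ℝ) (hρ : 0 < ρ) (M : ℕ) (hM : 2 ≤ M) :
    ∃ m : ℕ, ∃ γ : ℝ, 0 < γ ∧ ∀ N : ℕ, ∀ d : Fin N → ℂ, (∀ j, ‖d j‖ = 1) →
      ∃ ℓ : Fin N → Option (Fin m),
        (∀ j k, ℓ j ≠ ℓ k → ℓ j ≠ none → ℓ k ≠ none → γ ≤ ‖d j - d k‖ ^ 2) ∧
        (∀ j k a, ℓ j = some a → ℓ k = some a → ‖d j - d k‖ ≤ ρ) ∧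
        (N : ℝ) - N / M ≤ ((Finset.univ.filter fun k => ℓ k ≠ none).card : ℝ) ∧
        ((N : ℝ) - N / M) ^ 2 - ((Finset.univ.filter fun p : Fin N × Fin N => ‖d p.1 - d p.2‖ ≤ ρ).card : ℝ) ≤
          ((Finset.univ.filter fun p : Fin N × Fin N => ℓ p.1 ≠ ℓ p.2 ∧ ℓ p.1 ≠ none ∧ ℓ p.2 ≠ none).card : ℝ) := by
  -- number of arcs: m ≥ 2π/ρ and m ≥ 2
  set m : ℕ := ⌈2 * π / ρ⌉₊ + 2 with hmdef
  have hm2 : 2 ≤ m := by omega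
  have hmρ : 2 * π / m ≤ ρ := by
    have h1 : 2 * π / ρ ≤ (⌈2 * π / ρ⌉₊ : ℝ) := Nat.le_ceil _
    have hmR : (⌈2 * π / ρ⌉₊ : ℝ) + 2 = m := by rw [hmdef]; push_cast; ring
    have hmpos : (0 : ℝ) < m := by rw [← hmR]; positivity
    rw [div_le_iff₀ hmpos]
    have h2 : 2 * π ≤ ρ * (⌈2 * π / ρ⌉₊ : ℝ) := by rwa [div_le_iff₀' hρ] at h1
    nlinarith
  have hMpos : 0 < M := by omega
  have hK : 0 < m * M := Nat.mul_pos (by omega) hMpos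
  set γ : ℝ := 2 - 2 * Real.cos (2 * π / (m * M : ℕ)) with hγ
  have hγpos : 0 < γ := by
    have hKR : (0 : ℝ) < (m * M : ℕ) := by exact_mod_cast hK
    have hx0 : 0 < 2 * π / (m * M : ℕ) := by positivity
    have hx1 : 2 * π / (m * M : ℕ) < 2 * π := by
      rw [div_lt_iff₀ hKR]
      have : (1 : ℝ) < (m * M : ℕ) := by
        have h4 : (4 : ℕ) ≤ m * M := le_trans (by norm_num) (Nat.mul_le_mul hm2 hM)
        exact_mod_cast lt_of_lt_of_le (by norm_num : 1 < 4) h4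
      nlinarith [Real.pi_pos]
    have hne : Real.cos (2 * π / (m * M : ℕ)) ≠ 1 := by
      rw [Ne, Real.cos_eq_one_iff_of_lt_of_lt (by linarith) hx1]
      exact hx0.ne'
    have := lt_of_le_of_ne (Real.cos_le_one (2 * π / (m * M : ℕ))) hne
    rw [hγ]; linarith
  refine ⟨m, γ, hγpos, fun N d hd => ?_⟩
  obtain ⟨r, hrM, hcollar⟩ := exists_shift_few_collars (m := m) (M := M) hK d
  have hr : r < m * M := lt_of_lt_of_le hrM (Nat.le_mul_of_pos_left M (by omega))
  set ℓ : Fin N → Option (Fin m) := fun j => blockLabel m M r (d j) with hℓ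
  refine ⟨ℓ, fun j k hne h1 h2 => blockLabel_separated hr (hd j) (hd k) hne h1 h2,
    fun j k a hj hk => norm_sub_le_of_blockLabel_eq hm2 hmρ hr (hd j) (hd k) hj hk, ?_, ?_⟩
  · -- few collars
    have hTB : (((Finset.univ.filter fun k => ℓ k ≠ none).card : ℝ)) +
        ((Finset.univ.filter fun j => blockLabel m M r (d j) = none).card : ℝ) = N := by
      have h := Finset.card_filter_add_card_filter_not (s := (Finset.univ : Finset (Fin N))) (fun k => ℓ k = none)
      rw [Finset.card_univ, Fintype.card_fin, add_comm] at h
      exact_mod_cast h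
    have hMR : (0 : ℝ) < M := by exact_mod_cast hMpos
    have hB : ((Finset.univ.filter fun j => blockLabel m M r (d j) = none).card : ℝ) ≤ N / M := by
      rw [le_div_iff₀ hMR]; exact hcollar
    linarith
  · -- the count
    have h1 := card_pairs_ge_sq_sub_same ℓ
    -- same-label labelled pairs are ρ-close
    have h2 : ((Finset.univ.filter fun p : Fin N × Fin N => ℓ p.1 = ℓ p.2 ∧ ℓ p.1 ≠ none).card : ℝ) ≤
        ((Finset.univ.filter fun p : Fin N × Fin N => ‖d p.1 - d p.2‖ ≤ ρ).card : ℝ) := by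
      exact_mod_cast Finset.card_le_card (fun p hp => by
        rw [Finset.mem_filter] at hp ⊢
        obtain ⟨a, ha⟩ := Option.ne_none_iff_exists'.1 hp.2.2
        exact ⟨hp.1, norm_sub_le_of_blockLabel_eq hm2 hmρ hr (hd p.1) (hd p.2) ha (hp.2.1.symm.trans ha)⟩)
    -- T ≥ N − N/M
    have hTB : (((Finset.univ.filter fun k => ℓ k ≠ none).card : ℝ)) +
        ((Finset.univ.filter fun j => blockLabel m M r (d j) = none).card : ℝ) = N := by
      have h := Finset.card_filter_add_card_filter_not (s := (Finset.univ : Finset (Fin N))) (fun k => ℓ k = none)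
      rw [Finset.card_univ, Fintype.card_fin, add_comm] at h
      exact_mod_cast h
    have hMR : (0 : ℝ) < M := by exact_mod_cast hMpos
    have hB : ((Finset.univ.filter fun j => blockLabel m M r (d j) = none).card : ℝ) ≤ N / M := by
      rw [le_div_iff₀ hMR]; exact hcollar
    have hT : (N : ℝ) - N / M ≤ ((Finset.univ.filter fun k => ℓ k ≠ none).card : ℝ) := by linarith
    have hT0 : (0 : ℝ) ≤ (N : ℝ) - N / M := by
      have hN : (0 : ℝ) ≤ N := Nat.cast_nonneg N
      have : (N : ℝ) / M ≤ N := by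
        rw [div_le_iff₀ hMR]
        have : (1 : ℝ) ≤ M := by exact_mod_cast hMpos
        nlinarith
      linarith
    have hsq : ((N : ℝ) - N / M) ^ 2 ≤ (((Finset.univ.filter fun k => ℓ k ≠ none).card : ℝ)) ^ 2 :=
      pow_le_pow_left₀ hT0 hT 2
    linarith

end Summit.QuantumFields.YangMills.Theorems.EguchiKawaiDirectionLadder

end
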